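import Literature.Computability.Cryptography.RegevReductionCVPLiftStages
import Literature.Computability.Cryptography.RegevSamplerFormats
import Literature.Computability.Complexity.CodeFPRat
import Literature.Algebra.EuclideanLattices.GapInstanceCodeFP
import HarnessLib

/-!
# Regev 2009, Lemma 3.5 — the pre-processing program of `A_lift`, in polynomial time

Literature first-formalisation unit `b2b-lwe-3` (generation 6, fifth module), bundle
`papers/QuantumAdvantage/lwe-quantum-autopsy/`.  THE VALUE of this file is a THEOREM about a KNOWN
reduction (O. Regev, *On lattices, learning with errors, random linear codes, and cryptography*, J. ACM 56
(2009), Lemma 3.5: `CVP_{L*,d}` from `CVP^{(q)}_{L*,d}`) — NOT summit progress: it says nothing about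
`BQP ≠ BPP`, about the hardness of `LWE`, or about any open problem.

## What is proved

`RegevReductionCVPLiftStages.lean` reduced the named fact `A_lift`
(`regev2009_lemma_3_5_liftFamily q`) to the existence of two CLASSICAL polynomial-time string functions
— a pre-processing `h ∈ FP` and a post-processing `g ∈ FP` — with equational specifications along the
true digit path (`regev2009_lemma_3_5_liftFamily_of_wrapFns`).  This file BUILDS THE FIRST of the two and
proves its specification, leaving `A_lift` to hinge on the post-processing program alone:

* the TYPED VIEW of the strings involved (grouping namespace `Regev2009.LiftPre`): the header
  `((I, ρ), (k+1, y))` of a query (`Hdr`, code `hdrE`), the data of a `CVP_{L*,d}` query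
  `(header, (ℓ_R, b_c), residue table)` (`XData`, code `xE`), a stage input `(query data, i, window)`
  (`SData`, code `sE`); the codes ARE the tree's strings — `hdrE_mk`, **`xE_mk`**
  (`= CVPOracle.query I ρ k y c`), **`sE_mk`** (`= stageInput (CVPOracle.query …) i w`), `query_eq_pairE`
  (the `CVP^{(q)}` query `DigitOracle.query I ρ k y t` is the code of `(header, (tⱼ)ⱼ)`);
* **`ratList`** — the rational vector `(sⱼ/2^{ℓ_R})ⱼ` READ OFF the query data (dimension from the instance
  code, block width `ℓ_R` converted to unary against the table length, blocks read by
  `SamplerFormats.readN`), with **`ratList_mk`**: on the data of an in-range query it is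
  `List.ofFn (DigitOracle.ratOf c)`, and **`codeFP_ratList`**: it is computed on codes in polynomial time;
* **`preT`** — the typed pre-processing map: keep the header; at stage `0` attach the code of `ratList`,
  at later stages the first field of the window — with **`codeFP_preT`**;
* **`exists_liftPre`** — hence a string function `h ∈ FP` with
  `h (stageInput (CVPOracle.query I ρ k y c) 0 []) = DigitOracle.query I ρ k y (ratOf c)` for in-range `c`
  and `h (stageInput (CVPOracle.query I ρ k y c) (i+1) (boolPair (listE encodeRat (List.ofFn t)) rest))
  = DigitOracle.query I ρ k y t` for every window whose first field is the code of an iterate `t`;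
* **`regev2009_lemma_3_5_liftFamily_of_postFn`** — `A_lift` follows from the existence of ONE classical
  `g ∈ FP` (the post-processing: digit extraction, division by `q`, and the finish) together with the
  WINDOW DISCIPLINE that makes `h` correct: on the true path the window handed to working stage `i ≥ 1`
  is `boolPair (listE encodeRat (List.ofFn x̃ᵢ)) restᵢ` (`x̃ᵢ = DigitOracle.iter (q n) I (ratOf c) i`), the
  stage-`0` window is empty, every window has the advertised width, working stages map good answers to
  the next good window and idle stages copy deterministically
  (cf. `regev2009_lemma_3_5_liftFamily_of_wrapFns`, whose pre-processing clause is discharged here).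

Everything is proved (no new named fact); `A_lift` itself stays a named fact — what remains of it after
this file is the post-processing program `g` and its window bookkeeping (referee notes N-14.1, N-14.4,
N-14.5 of the bundle), whose exact-arithmetic content is `RegevReductionCVPLiftExact.lean`.

## References

* O. Regev, *On lattices, learning with errors, random linear codes, and cryptography*, J. ACM 56 (2009),
  art. 34; author's version arXiv:2401.03703: Lemma 3.5 and its proof (p. 19: "find its coset using the
  `CVP^{(q)}` oracle, subtract, divide by `q`") [Regev2009].
* S. Arora, B. Barak, *Computational Complexity: A Modern Approach*, CUP 2009, §1.2–1.3 (polynomial-time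
  string functions, representation independence) [AroraBarak2009].
-/

namespace Literature.Computability.Cryptography

open Filter _root_.Computability Literature.Computability.Complexity Literature.Computability.Complexity.CodeFP
open Literature.Computability.QuantumComplexity Literature.Algebra.EuclideanLattices
open Regev2009 Regev2009.DigitOracle Regev2009.SamplerFormats Brick

namespace Regev2009

namespace LiftPre

/-! ### The typed view of queries and stage inputs -/

/-- **Query header**: the instance with its parameter, the round counter and the coin prefix,
`((I, ρ), (k+1, y))`. [cite: Regev2009, Lemma 3.5 (proof)] -/
abbrev Hdr : Type := GapSVPInstance × ℕ × List Bool

/-- Its code `⟨⟨code (I, ρ), ⟨1^{k+1}, y⟩⟩`. [cite: AroraBarak2009, §1.2 (codes of tuples)] -/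
abbrev hdrE : Hdr → List Bool := pairE GapSVPInstance.encode (pairE unE strE)

/-- **Data of a `CVP_{L*,d}` query**: header with the numerals `(ℓ_R, b_c)`, then the residue table.
[cite: Regev2009, Lemma 3.5 (proof)] -/
abbrev XData : Type := (Hdr × (ℕ × ℕ)) × List Bool

/-- Its code. [cite: AroraBarak2009, §1.2 (codes of tuples)] -/
abbrev xE : XData → List Bool := pairE (pairE hdrE (pairE natE natE)) strE

/-- **Data of a stage input**: query data, stage number, window. [cite: Regev2009, Lemma 3.5 (proof)] -/
abbrev SData : Type := XData × ℕ × List Bool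

/-- Its code. [cite: AroraBarak2009, §1.2 (codes of tuples)] -/
abbrev sE : SData → List Bool := pairE xE (pairE unE strE)

/-- The query data of `c = (s, ℓ_R, b_c)` in round `k` with coins `y`. [cite: Regev2009, Lemma 3.5 (proof)] -/
def xOf (I : LatticeInstance) (ρ : ℚ) (k : ℕ) (y : List Bool) (c : CVPOracle.QData I.n) : XData :=
  ((((I, ρ), k + 1, y), (c.2.1, c.2.2)), CVPOracle.table c.2.1 c.1)

/-- The header code is the tree's header string. [folklore] -/
theorem hdrE_mk (I : LatticeInstance) (ρ : ℚ) (k : ℕ) (y : List Bool) :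
    hdrE ((I, ρ), k + 1, y) = stageInput (GapSVPInstance.encode (I, ρ)) (k + 1) y := by
  simp [pairE, strE, unE_eq_ones, ones, stageInput]

/-- **The code of the query data is the query string.** [cite: Regev2009, Lemma 3.5 (proof)] -/
theorem xE_mk (I : LatticeInstance) (ρ : ℚ) (k : ℕ) (y : List Bool) (c : CVPOracle.QData I.n) :
    xE (xOf I ρ k y c) = CVPOracle.query I ρ k y c := by
  simp [xOf, pairE, strE, natE, unE_eq_ones, ones, stageInput, CVPOracle.query]

/-- **The code of the stage data is the stage input string.** [cite: Regev2009, Lemma 3.5 (proof)] -/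
theorem sE_mk (I : LatticeInstance) (ρ : ℚ) (k : ℕ) (y : List Bool) (c : CVPOracle.QData I.n)
    (i : ℕ) (w : List Bool) :
    sE (xOf I ρ k y c, i, w) = stageInput (CVPOracle.query I ρ k y c) i w := by
  rw [← xE_mk]
  simp [pairE, strE, unE_eq_ones, ones, stageInput]

/-- **The `CVP^{(q)}` query is the code of `(header, iterate)`.** [cite: Regev2009, Lemma 3.5 (proof)] -/
theorem query_eq_pairE (I : LatticeInstance) (ρ : ℚ) (k : ℕ) (y : List Bool) (t : Fin I.n → ℚ) :
    DigitOracle.query I ρ k y t = pairE hdrE (listE encodeRat) (((I, ρ), k + 1, y), List.ofFn t) := by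
  simp [DigitOracle.query, pairE, strE, unE_eq_ones, ones, stageInput]

/-! ### Reading the rational query point off the data -/

/-- **The rational vector `(sⱼ / 2^{ℓ_R})ⱼ` read off the query data**: `n` from the instance code, the
block width `min ℓ_R |table|` (`= ℓ_R` as soon as `n ≥ 1`), the `n` blocks as naturals.
[cite: Regev2009, Lemma 3.5 (proof: "given a point x")] -/
def ratList (d : XData) : List ℚ :=
  (readN (min d.1.2.1 d.2.length) d.1.1.1.1.n d.2).map
    fun v : ℕ => ((v : ℤ) : ℚ) / ((2 ^ min d.1.2.1 d.2.length : ℕ) : ℚ)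

/-- **On an in-range query the list read is the rational query point.**
[cite: Regev2009, Lemma 3.5 (proof)] -/
theorem ratList_mk (I : LatticeInstance) (ρ : ℚ) (k : ℕ) (y : List Bool) (c : CVPOracle.QData I.n)
    (hc : CVPOracle.InRange c) : ratList (xOf I ρ k y c) = List.ofFn (ratOf c) := by
  have hlen : (CVPOracle.table c.2.1 c.1).length = I.n * c.2.1 := by
    rw [← tableL_ofFn, length_tableL, List.length_ofFn]
  rcases Nat.eq_zero_or_pos I.n with h0 | hpos
  · have h1 : readN (min c.2.1 (CVPOracle.table c.2.1 c.1).length) I.n (CVPOracle.table c.2.1 c.1) = [] :=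
      List.eq_nil_of_length_eq_zero (by simp [readN, h0])
    have h2 : List.ofFn (ratOf c) = [] := List.eq_nil_of_length_eq_zero (by rw [List.length_ofFn, h0])
    simp only [ratList, xOf, h1, List.map_nil, h2]
  · have hmin : min c.2.1 (CVPOracle.table c.2.1 c.1).length = c.2.1 := by
      rw [hlen]; exact min_eq_left (Nat.le_mul_of_pos_left _ hpos)
    have hs : ∀ v ∈ List.ofFn c.1, v < 2 ^ c.2.1 := by
      intro v hv
      obtain ⟨j, rfl⟩ := (List.mem_ofFn' _ _).1 hv
      exact hc j
    have hr := readN_tableL hs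
    rw [List.length_ofFn, tableL_ofFn] at hr
    simp only [ratList, xOf, hmin, hr, List.map_ofFn]
    congr 1
    funext j
    simp only [Function.comp_apply, ratOf]
    push_cast
    ring

/-- **The rational query point is read in polynomial time.** [cite: AroraBarak2009, §1.3] -/
theorem codeFP_ratList : CodeFP xE (listE encodeRat) ratList := by
  have hn : CodeFP xE unE (fun d => d.1.1.1.1.n) := GapCodes.svpNUn_codeFP.comp (fst _ _).fst'.fst'
  have hℓ : CodeFP xE natE (fun d => d.1.2.1) := (fst _ _).snd'.fst'
  have htab : CodeFP xE strE (fun d => d.2) := snd _ _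
  have hℓu : CodeFP xE unE (fun d => min d.1.2.1 d.2.length) :=
    unOfNatMin.comp ((strLength.comp htab).pair hℓ)
  have hread : CodeFP xE (rawE natE) (fun d => readN (min d.1.2.1 d.2.length) d.1.1.1.1.n d.2) :=
    codeFP_readN.comp (hℓu.pair (hn.pair htab))
  have htwo : CodeFP xE natE (fun _ => 2) := const xE 2
  have hpow : CodeFP xE natE (fun d => 2 ^ min d.1.2.1 d.2.length) := natPow.comp (htwo.pair hℓu)
  -- (the element map is assembled WITHOUT a target ascription: unifying the cast-laden lambda
  -- against `ratOfIntNat ∘ …` head-on is a known heartbeat sink)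
  have hg1 : CodeFP (pairE xE natE) (pairE intE natE)
      (fun p => ((p.2 : ℤ), 2 ^ min p.1.1.2.1 p.1.2.length)) :=
    (intOfNat.comp (snd _ _)).pair (hpow.comp (fst _ _))
  have hg := ratOfIntNat.comp hg1
  have hmap := (map hg).comp ((CodeFP.id xE).pair hread)
  exact ((listOfRaw encodeRat).comp hmap).congr fun d => by simp only [ratList, id]

/-! ### The pre-processing map -/

/-- **The typed pre-processing map of the lift**: keep the header; at stage `0` the query point read off
the data, at later stages the iterate stored in the first field of the window.
[cite: Regev2009, Lemma 3.5 (proof: "a sequence of points x₁ = x, x₂, …")] -/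
def preT (a : SData) : Hdr × List Bool :=
  (a.1.1.1, if decide (a.2.1 = 0) then listE encodeRat (ratList a.1) else fstF a.2.2)

/-- **The pre-processing map is computed in polynomial time.** [cite: AroraBarak2009, §1.3] -/
theorem codeFP_preT : CodeFP sE (pairE hdrE strE) preT := by
  have hi : CodeFP sE unE (fun a => a.2.1) := (snd _ _).fst'
  have hzero : CodeFP sE unE (fun _ => 0) := const sE 0
  have hp : CodeFP sE bitE (fun a => decide (a.2.1 = 0)) := (CodeFP.eq unE_injective).comp (hi.pair hzero)
  have hg : CodeFP sE strE (fun a => listE encodeRat (ratList a.1)) :=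
    (codeFP_ratList.comp (fst _ _)).recodeOut fun _ => rfl
  have hfst : CodeFP strE strE fstF := of_fn fstF fstF_mem_FP fun _ => rfl
  have hh : CodeFP sE strE (fun a => fstF a.2.2) := hfst.comp (snd _ _).snd'
  exact ((fst _ _).fst'.fst'.pair (ite hp hg hh)).congr fun a => rfl

/-- Stage `0`: the attached field is the code of the query point. [cite: Regev2009, Lemma 3.5 (proof)] -/
theorem preT_zero (d : XData) : preT (d, 0, []) = (d.1.1, listE encodeRat (ratList d)) := by
  simp [preT]

/-- Later stages: the attached field is the first field of the window. [cite: Regev2009, Lemma 3.5 (proof)] -/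
theorem preT_succ (d : XData) (i : ℕ) (a rest : List Bool) :
    preT (d, i + 1, boolPair a rest) = (d.1.1, a) := by
  simp [preT]

end LiftPre

open LiftPre in
/-- **The pre-processing program of the lift exists in `FP`**: a classical polynomial-time string
function turning the stage input of working stage `i` into the `CVP^{(q)}` query for the `i`-th iterate
— at stage `0` the query point `(sⱼ/2^{ℓ_R})ⱼ` itself (read off the `CVP_{L*,d}` query), at stage `i+1`
the iterate stored in the first field of the window. [cite: Regev2009, Lemma 3.5 (proof: "find its coset using the CVP^{(q)} oracle")] -/
theorem exists_liftPre : ∃ h : List Bool → List Bool, h ∈ FP ∧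
    (∀ (I : LatticeInstance) (ρ : ℚ) (k : ℕ) (y : List Bool) (c : CVPOracle.QData I.n),
      CVPOracle.InRange c →
        h (stageInput (CVPOracle.query I ρ k y c) 0 []) = DigitOracle.query I ρ k y (ratOf c)) ∧
    (∀ (I : LatticeInstance) (ρ : ℚ) (k : ℕ) (y : List Bool) (c : CVPOracle.QData I.n) (i : ℕ)
      (t : Fin I.n → ℚ) (rest : List Bool),
        h (stageInput (CVPOracle.query I ρ k y c) (i + 1) (boolPair (listE encodeRat (List.ofFn t)) rest))
          = DigitOracle.query I ρ k y t) := by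
  obtain ⟨f, hf, hfe⟩ := codeFP_preT
  refine ⟨f, hf, fun I ρ k y c hc => ?_, fun I ρ k y c i t rest => ?_⟩
  · rw [← sE_mk, hfe, preT_zero, ratList_mk I ρ k y c hc, query_eq_pairE]
    rfl
  · rw [← sE_mk, hfe, preT_succ, query_eq_pairE]
    rfl

end Regev2009

/-! ### `A_lift` from the post-processing program alone -/

section LiftPre

variable (q : ℕ → ℕ)

open Regev2009 Regev2009.DigitOracle

/-- **Regev's Lemma 3.5, machine form: `A_lift` follows from ONE classical polynomial-time program** —
the post-processing `g ∈ FP` of the stages — **and its window discipline.**  With `x` the `CVP_{L*,d}`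
query and `x̃ᵢ = DigitOracle.iter (q n) I (ratOf c) i` the true iterates, it suffices that for a stage
count `Ts`, a window width `ms` and a working-stage count `pR` (polynomials), eventually in `n`, every
admissible query admits good windows `gw` with `gw 0 = []`, the `CVP_{L*,d}` answer a prefix of the last
one, all of width `ms |x|`, and at each stage EITHER (working, `i < pR n`) the window — when `i ≥ 1` — has
first field the code `listE encodeRat (List.ofFn x̃ᵢ)` and `g` maps every answer extending the correct
`CVP^{(q)}` answer for `x̃ᵢ` to the next good window, OR (idle) `g` outputs the next good window whatever
the answer.  The pre-processing program is supplied by `exists_liftPre`; the rest is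
`regev2009_lemma_3_5_liftFamily_of_wrapFns`. [cite: Regev2009, Lemma 3.5 (proof)] -/
theorem regev2009_lemma_3_5_liftFamily_of_postFn
    (hG : PolyTimeComputable unaryEncodeNat encodeNat q → (∀ᶠ n : ℕ in atTop, 2 ≤ q n) →
      ∀ T : UniformQCircuitFamily, ∃ g : List Bool → List Bool, g ∈ FP ∧
        ∃ (Ts ms pR : Polynomial ℕ), ∀ᶠ n : ℕ in atTop,
          ∀ (I : LatticeInstance) (ρ : ℚ) (k : ℕ) (y : List Bool), I.n = n → I.IsNonsingular →
            ∀ d : ℝ, d < minNorm (dualLattice I.lattice) / 2 →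
              ∀ c : CVPOracle.QData I.n, CVPOracle.Admissible I d c →
                ∃ gw : ℕ → List Bool, gw 0 = [] ∧
                  CVPOracle.answerTable I c <+: gw (Ts.eval (CVPOracle.query I ρ k y c).length) ∧
                  ∀ i < Ts.eval (CVPOracle.query I ρ k y c).length,
                    (gw (i + 1)).length = ms.eval (CVPOracle.query I ρ k y c).length ∧
                    ((i < pR.eval n ∧
                        (i ≠ 0 → ∃ rest : List Bool, gw i =
                          boolPair (listE encodeRat (List.ofFn (iter (q n) I (ratOf c) i))) rest) ∧
                        ∀ yy : List Bool, answerTable (q n) I (iter (q n) I (ratOf c) i) <+: yy →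
                          g (boolPair (stageInput (CVPOracle.query I ρ k y c) i (gw i)) yy) = gw (i + 1)) ∨
                      ∀ yy : List Bool,
                        g (boolPair (stageInput (CVPOracle.query I ρ k y c) i (gw i)) yy) = gw (i + 1))) :
    regev2009_lemma_3_5_liftFamily q := by
  obtain ⟨h, hh, h0, hS⟩ := exists_liftPre
  refine regev2009_lemma_3_5_liftFamily_of_wrapFns q fun hq hq2 T => ?_
  obtain ⟨g, hg, Ts, ms, pR, hev⟩ := hG hq hq2 T
  refine ⟨h, g, hh, hg, Ts, ms, pR, ?_⟩
  filter_upwards [hev] with n hn I ρ k y hIn hI d hd c hc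
  obtain ⟨gw, hgw0, hgwA, hst⟩ := hn I ρ k y hIn hI d hd c hc
  refine ⟨gw, hgw0, hgwA, fun i hi => ?_⟩
  obtain ⟨hlen, hcase⟩ := hst i hi
  refine ⟨hlen, ?_⟩
  rcases hcase with ⟨hip, hwin, hgood⟩ | hidle
  · refine Or.inl ⟨hip, ?_, hgood⟩
    rcases Nat.eq_zero_or_pos i with rfl | hpos
    · rw [hgw0, iter_zero]
      exact h0 I ρ k y c hc.1
    · obtain ⟨rest, hrest⟩ := hwin hpos.ne'
      obtain ⟨i', rfl⟩ := Nat.exists_eq_succ_of_ne_zero hpos.ne'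
      rw [hrest]
      exact hS I ρ k y c i' _ rest
  · exact Or.inr hidle

end LiftPre

end Literature.Computability.Cryptography
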